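import Summits.BirchSwinnertonDyer.BirchSwinnertonDyer.Theorems.Rank1ResidualX9Defs
import Literature.NumberTheory.EllipticCurves.Rank1Residual.X9MuInvariant
import Literature.NumberTheory.EllipticCurves.Rank1Residual.ClassX1KellerYinCertificate
import HarnessLib

/-!
# Class X9: the `μ`-transfer `μ(L_p(E)) = 0 ⟹ μ(X(E/ℚ_∞)) = 0` at an IRREDUCIBLE image, TYPED, and
# the K6 input bridges `IntegralMainConjectureOnClassX9` / `BSDpOnClassX9` ⟸ (transfer) ∧ (analytic `μ = 0` on X9)
# (cell `bsd-smallim`, seat `koly`, gen 3; memo HOME/koly/KOLY-MEMO.md v1.6 §5.7)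

HONEST FRAMING (cell `bsd-smallim`, FULL-BSD rank-`≤ 1` programme tranche 1b): provers of the cell
write PROOFS from published inputs and have them refereed inside the cell; a PASSed memo is a CELL
THEOREM, not a Literature fact and not a kernel proof. This file asserts NOTHING about any curve: it
introduces two `Prop`-valued names (`@[conjecture]`, i.e. OPEN obligation nodes in the kernel's
bookkeeping) and proves, sorry-free, the bridges by which they feed the cell's typed targets of
`Rank1ResidualX9Defs.lean` through the published-input kernels of
`Literature/…/Rank1Residual/X9MuInvariant.lean`.

* `KatoMuTransfer` — KOLY-MEMO v1.6 Cor. 5.7.2 (iii) in the tree's currency: for `E = W/ℚ` globally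
  minimal, `p ≥ 5` good ordinary with `E[p]` irreducible (ANY image: surjective or not), and a newform
  `f` of `E`, ONE `p`-adic unit among the coefficients of `L_p(f, α)` (the lane's finite certificate
  "`μ(𝓛_p(E)) = 0`") forces `μ(X) = 0` for every cyclotomic Selmer dual datum `D` (`D.mu = 0`). The
  memo PROVES this (§5.7: Theorem 5.7.1 — one `E`-split Kolyvagin prime of rank two over
  `Λ/p = 𝔽_p⟦T⟧` makes the mod-`p` dual Selmer group `Ш¹_S(ℚ, 𝒯^∨)` finite as soon as Kato's
  `(c,d)`-integral `Λ`-adic class is non-zero mod `p`; no surjectivity, no hypothesis (im)/(12.5.2),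
  and — new in v1.6 — no non-degeneracy condition (ND), thanks to the `ι`-semilinearity of
  `G_ℚ`-equivariant maps `𝒯_e → 𝒯_e^* = E[p] ⊗ A_e(χ_Λ^{-1})`, Lemmas 5.7.A/B — plus the CITED
  conversions [Kato 2004, 12.6/16.6/17.11/17.13] refereed in REF-KOLY-VERDICT v3 §2.4); the referee's
  word on §5.7 is pending at filing time, so the name is an OBLIGATION node, nothing is asserted.
* `AnalyticMuZeroOnClassX9` — Greenberg's conjecture `μ = 0` on its ANALYTIC side, restricted to class
  X9: every X9 pair carries the unit-coefficient certificate. Certified per pair by the lane's engines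
  (exact modular symbols); OPEN as a class statement (the programme's barrier B3). Nothing asserted.
* `integralMainConjectureOnClassX9_of_katoMuTransfer` — KERNEL: BCS 2025 Thm. 1.1.2 (a) (`hBCS`) ∧
  `KatoMuTransfer` ∧ `AnalyticMuZeroOnClassX9` ⟹ `IntegralMainConjectureOnClassX9` (the typed
  rank-`0` engine of X9), via `mazurMainConjecture_of_mu_eq_zero`.
* `mu_eq_zero_of_katoMuTransfer_of_analyticMuZero` — per pair: the two inputs give `D.mu = 0` for all
  cyclotomic data (the `hμ` binder of `X9MuInvariant.lean`).
* `bsdpOnClassX9_of_katoMuTransfer` — KERNEL: the PUBLISHED binders of `X9MuInvariant.lean` (BCS (a),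
  Greenberg 4.1, period unit, Perrin-Riou–Schneider, Perrin-Riou 1987, modularity, GZK) ∧
  `KatoMuTransfer` ∧ `AnalyticMuZeroOnClassX9` ∧ the Schneider certificate C3 on the rank-`1` X9 pairs
  ⟹ `BSDpOnClassX9` (the cell's typed TARGET, both analytic ranks).

So the construction-shaped residue K6 of the programme ("integral Kato divisibility / Kolyvagin
systems for irreducible NON-surjective image") is REDUCED IN THE KERNEL to the two named inputs; the
memo discharges the first on paper. No pair, class, label or count of record is moved by this file.
-/

-- the summit and its single problem are both named `BirchSwinnertonDyer` (registry layout D-0017)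
set_option linter.dupNamespace false

set_option autoImplicit false

noncomputable section

open scoped Classical MatrixGroups ModularForm

open CongruenceSubgroup WeierstrassCurve Field
open Literature.NumberTheory.EllipticCurves Literature.NumberTheory.EllipticCurves.ModularForms
open Literature.NumberTheory.EllipticCurves.Rank1Residual (mazurMainConjecture_of_mu_eq_zero
  mazurMainConjecture_neron_of_mu_eq_zero norm_periodRatio_eq_one pPart_of_bsdp)

namespace Summit.BirchSwinnertonDyer.BirchSwinnertonDyer.Rank1Residual

/-! ### The two K6 inputs, typed -/

/-- **KOLY-MEMO v1.6 Cor. 5.7.2 (iii) — the `μ`-transfer at an irreducible image (cell theorem on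
paper; OPEN obligation node in the kernel, nothing asserted).** For every globally minimal `W/ℚ`,
every prime `p ≥ 5` of good ordinary reduction with `E[p]` irreducible (no surjectivity hypothesis),
and every newform `f` of `W`: if SOME coefficient of the `p`-adic `L`-function `L_p(f, α)`
(`α = unitRoot W p`) is a `p`-adic unit — i.e. `μ(L_p(E)) = 0`, the lane's finite modular-symbol
certificate — then for all cyclotomic data `(κ, γ)` and every Selmer dual datum `D`, `μ(X) = 0`
(`D.mu = 0`). Binder for binder the `hcert ⟹ hμ` implication in the currency of
`X9MuInvariant.lean`. Memo proof (§5.7, inputs [Kato 2004, Thms 12.4 (3), 12.5 (3), 12.6, §13.1–13.3,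
16.6, 17.11, 17.13]): `μ(L_p) = 0` ⟹ Kato's integral `Λ`-adic class `𝐳_1 ∉ p·𝐇¹` (12.6 + p. 280)
⟹ (Thm 5.7.1: one `E`-split prime `q` with `p^{m₀} ∥ q − 1`, Kolyvagin class over `Ω/T^{2e}`,
Chebotarev at level `e`, Poitou–Tate reciprocity) `Ш¹_S(ℚ, E[p] ⊗ (Λ/p)^∨)` finite ⟹
`μ(H²(G_S, T_pE ⊗ Λ)) = 0` ⟹ (17.13) `μ(X(E/ℚ_∞)) = 0`. At a surjective image this is the `μ`-part
of Kato's Thm 17.4 (3). [cite: Kato2004Asterisque, Thm. 12.6, Thm. 17.4 (3) and 17.13 (p. 280)]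
[cite: GreenbergLNM1716, §1 Conj. 1.11] -/
@[conjecture] def KatoMuTransfer : Prop :=
  ∀ (W : WeierstrassCurve ℚ) [W.IsElliptic] [W.IsGloballyMinimal] (p : ℕ) [Fact p.Prime]
    {N : ℕ} [NeZero N] (f : CuspForm (Gamma0 N) 2),
    5 ≤ p → W.HasGoodReductionAtPrime p → ¬ (p : ℤ) ∣ W.frobeniusTrace p →
    W.HasIrreducibleModPGaloisRep p → IsNewformOf W f →
    (∃ n : ℕ, ‖PowerSeries.coeff n (padicLFunction f (unitRoot W p : ℚ_[p]))‖ = 1) →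
    ∀ (κ : ZpExtension ℚ p) (γ : Field.absoluteGaloisGroup ℚ),
      κ.IsCyclotomic → κ.IsTopGenerator γ → IsCyclotomicVariable p γ →
      ∀ D : W.SelmerDualData κ γ, D.mu = 0

/-- **Greenberg's `μ = 0`, ANALYTIC side, on class X9 (OPEN as a class statement; certified per
pair; nothing asserted).** For every X9 pair `(W, p)` (`Rank1ResidualX9Defs.ClassX9`: non-CM,
`p ≥ 5` good ordinary, `E[p]` irreducible, `ρ̄` not surjective) and every newform `f` of `W`, some
coefficient of `L_p(f, α)` is a `p`-adic unit: `μ(L_p(E)) = 0`. Greenberg conjectures `μ = 0`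
(algebraic, equivalently analytic under the main conjecture) whenever `E[p]` is irreducible; the
lane's Iwasawa-census engines verify the unit coefficient per pair (e.g. `2268b1 @ 5`: constant term
a unit). The programme's barrier B3, isolated as the class-wide residue of X9 by the memo's Cor. 5.7.2.
[cite: GreenbergLNM1716, §1 Conj. 1.11] -/
@[conjecture] def AnalyticMuZeroOnClassX9 : Prop :=
  ∀ (W : WeierstrassCurve ℚ) [W.IsElliptic] [W.IsGloballyMinimal] (p : ℕ) [Fact p.Prime]
    {N : ℕ} [NeZero N] (f : CuspForm (Gamma0 N) 2),
    ClassX9 W p → IsNewformOf W f →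
    ∃ n : ℕ, ‖PowerSeries.coeff n (padicLFunction f (unitRoot W p : ℚ_[p]))‖ = 1

/-! ### Kernel bridges: the K6 leaf from the two inputs -/

/-- **Per pair: transfer ∧ analytic certificate ⟹ `μ(X) = 0` for all cyclotomic data** — the `hμ`
binder of `X9MuInvariant.lean` at an X9 pair, from `KatoMuTransfer` and `AnalyticMuZeroOnClassX9`,
through any newform of `W` (one exists by modularity, `hmodP`). [folklore] -/
theorem mu_eq_zero_of_katoMuTransfer_of_analyticMuZero
    (hmodP : nonempty_modularParametrizationData)
    (hT : KatoMuTransfer) (hA : AnalyticMuZeroOnClassX9)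
    (W : WeierstrassCurve ℚ) [W.IsElliptic] [W.IsGloballyMinimal] (p : ℕ) [Fact p.Prime]
    (hX9 : ClassX9 W p) :
    ∀ (κ : ZpExtension ℚ p) (γ : Field.absoluteGaloisGroup ℚ),
      κ.IsCyclotomic → κ.IsTopGenerator γ → IsCyclotomicVariable p γ →
      ∀ D : W.SelmerDualData κ γ, D.mu = 0 := by
  intro κ γ hκ hγ hγ' D
  obtain ⟨-, hp, hgood, hord, hirr, -⟩ := id hX9
  haveI : NeZero (W.conductorNorm ℤ) := ⟨(W.conductorNorm_pos_holds).ne'⟩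
  obtain ⟨Dm⟩ := hmodP W
  exact hT W p Dm.f hp hgood hord hirr Dm.isNewformOf (hA W p Dm.f hX9 Dm.isNewformOf) κ γ hκ hγ hγ' D

/-- **K6 rank-`0` engine from the two inputs (KERNEL).** BCS 2025 Thm. 1.1.2 (a) (`hBCS`, the
rational main conjecture `ch X = (p^k L_p)` at a good ordinary `p > 3` under (irr) — PUBLISHED), the
`μ`-transfer `KatoMuTransfer` (memo Cor. 5.7.2, paper) and the analytic `μ = 0` on X9 give the typed
missing input `IntegralMainConjectureOnClassX9`: `ch_Λ X(E/ℚ_∞) = (L_p(E))` in `Λ` at every X9 pair.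
Proof: the two inputs give `D.mu = 0`; `mazurMainConjecture_of_mu_eq_zero` (BCS (a) + GV 2000 Prop.
3.7 + the unit coefficient) pins the exponent `k = 0`.
[cite: BurungaleCastellaSkinner2025, Thm. 1.1.2 (a) (p. 2 of arXiv:2405.00270v2)]
[cite: GreenbergVatsal2000, Prop. 3.7] -/
theorem integralMainConjectureOnClassX9_of_katoMuTransfer
    (hBCS : burungale_castella_skinner_charIdeal_eq_padicLFunction)
    (hT : KatoMuTransfer) (hA : AnalyticMuZeroOnClassX9) : IntegralMainConjectureOnClassX9 := by
  intro W _ _ p _ κ γ N _ f hX9 hκ hγ hγ' hf D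
  obtain ⟨-, hp, hgood, hord, hirr, -⟩ := id hX9
  have hcert : ∃ n : ℕ, ‖PowerSeries.coeff n (padicLFunction f (unitRoot W p : ℚ_[p]))‖ = 1 :=
    hA W p f hX9 hf
  have hμ : D.mu = 0 := hT W p f hp hgood hord hirr hf hcert κ γ hκ hγ hγ' D
  exact mazurMainConjecture_of_mu_eq_zero hBCS W p hp hgood hord hirr κ γ hκ hγ hγ' f hf D hμ hcert

/-- **K6 leaf from the two inputs (KERNEL): `BSDpOnClassX9`, both analytic ranks.** PUBLISHED
binders, exactly those of `X9.bsdp_of_mu_eq_zero_of_analyticRank_le_one`: BCS 2025 Thm. 1.1.2 (a)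
(`hBCS`), Greenberg LNM 1716 Thm. 4.1 (`hGr`), the period unit `Ω_E = u·Ω⁺_f` (`h5`),
Perrin-Riou–Schneider (`hS`), Perrin-Riou 1987 (`hPR`), modularity (`hmodP`, `hmodL`),
Gross–Zagier–Kolyvagin (`hGZK`). CELL inputs: `KatoMuTransfer` (memo Cor. 5.7.2, paper-proved) and
`AnalyticMuZeroOnClassX9` (barrier B3). RIDER (I1): the Schneider certificate C3 at the rank-`1` X9
pairs (`hC3`; per pair it is `[T¹]L_p ≠ 0`, `Wuthrich2014.coeff_one_padicLFunction_ne_zero_iff_schneider`).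
Deduction: `μ = 0` per pair (`mu_eq_zero_of_katoMuTransfer_of_analyticMuZero`), the certificate in the
`ϖ`-shape (`‖ϖ‖ = 1`, `norm_periodRatio_eq_one`), Mazur's main conjecture in the Néron normalisation
(`mazurMainConjecture_neron_of_mu_eq_zero`), then rank `0`: CGLS 2022 Thm. 5.1.4's valuation chain
(`padicValRat_bsd_rank_zero_of_mazurMainConjecture`, `bsdp_of_padicValRat_rank_zero`); rank `1`:
Wuthrich's engine (`Wuthrich2014.missingPPartAt_of_mainConjecture_of_rank_one`,
`Typed.bsdp_of_missingPPartAt`); finally Miller's `BSD(E,p)` back to the print shape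
(`pPart_of_bsdp`, `pPartBSD_iff_pPart`). Nothing is booked: the two cell inputs are open nodes.
[cite: GreenbergLNM1716, Thm. 4.1 (p. 102) and §1 Conj. 1.11]
[cite: CastellaEtAl2021, Thm. 5.1.4 and its proof (§5.1.3)] [cite: PerrinRiou1987, §1.4 Cor. 1.8]
[cite: Miller2011LMS, §1 and Def. 1.1] -/
theorem bsdpOnClassX9_of_katoMuTransfer
    (hBCS : burungale_castella_skinner_charIdeal_eq_padicLFunction)
    (hGr : greenberg_charValue_rankZero) (h5 : realPeriodRat_eq_unit_mul_plusPeriod)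
    (hS : Schneider1985_order_charGenerator) (hPR : perrinRiou_rankOne_leadingTerms)
    (hmodP : nonempty_modularParametrizationData) (hmodL : hasEntireLFunction_rat)
    (hGZK : rank_eq_analyticRank_of_analyticRank_le_one)
    (hT : KatoMuTransfer) (hA : AnalyticMuZeroOnClassX9)
    (hC3 : ∀ (W : WeierstrassCurve ℚ) [W.IsElliptic] [W.IsGloballyMinimal] (p : ℕ) [Fact p.Prime],
      ClassX9 W p → W.analyticRank = 1 →
        ∀ Dh : PAdicHeightData W p, Dh.IsCanonical → SchneiderConjecture Dh) :
    BSDpOnClassX9 := by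
  intro W _ _ p _ hran hX9 hfin
  obtain ⟨-, hp, hgood, hord, hirr, -⟩ := id hX9
  -- `μ = 0` for every cyclotomic datum
  have hμ := mu_eq_zero_of_katoMuTransfer_of_analyticMuZero hmodP hT hA W p hX9
  -- the certificate in the `ϖ`-shape of `X9MuInvariant.lean`
  have hcert : ∀ [NeZero (W.conductorNorm ℤ)] (f : CuspForm (Gamma0 (W.conductorNorm ℤ)) 2),
      IsNewformOf W f → ∀ (ϖ : ℚ), (ϖ : ℝ) * W.realPeriodRat = plusPeriod f →
      ∃ n : ℕ, ‖PowerSeries.coeff n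
        (PowerSeries.C (ϖ : ℚ_[p]) * padicLFunction f (unitRoot W p : ℚ_[p]))‖ = 1 := by
    intro _ f hf ϖ hϖeq
    obtain ⟨n, hn⟩ := hA W p f hX9 hf
    refine ⟨n, ?_⟩
    rw [PowerSeries.coeff_C_mul, norm_mul, norm_periodRatio_eq_one h5 W p hp hgood hirr f hf ϖ hϖeq,
      one_mul]
    exact hn
  have hMC := mazurMainConjecture_neron_of_mu_eq_zero hBCS h5 W p hp hgood hord hirr hμ hcert
  have hbsdp : BSDp W p := by
    rcases Nat.le_one_iff_eq_zero_or_eq_one.mp hran with hr | hr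
    · -- analytic rank 0: CGLS's valuation chain
      have hp2 : p ≠ 2 := by omega
      have hL : W.entireLFunction 1 ≠ 0 := (W.analyticRank_eq_zero_iff_holds (hmodL W)).1 hr
      exact bsdp_of_padicValRat_rank_zero W p hr hL hGZK
        (padicValRat_bsd_rank_zero_of_mazurMainConjecture W p hgood hord hL hfin hmodP
          (hGr W p hp2 hgood hord) hMC)
    · -- analytic rank 1: Wuthrich's engine, Schneider certificate supplied by `hC3`
      exact Literature.NumberTheory.EllipticCurves.Rank1Residual.Typed.bsdp_of_missingPPartAt W p hGZK
        (by omega)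
        (Wuthrich2014.missingPPartAt_of_mainConjecture_of_rank_one hS hPR hmodP hGZK W p hp hgood
          hord hr (hC3 W p hX9 hr) hMC)
  exact (pPartBSD_iff_pPart W p).mpr (pPart_of_bsdp hmodL hGZK W p hran hbsdp)

end Summit.BirchSwinnertonDyer.BirchSwinnertonDyer.Rank1Residual
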